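import Mathlib
import HarnessLib

/-!
# Walsh–Fourier bookkeeping on `{±1}^t` for the clipping lemma `stub_walshClipping` (auxiliary file)

Crux `AbsoluteUpgrade` (stmt-Parity-14116), line `nlc-cells-absolute-clip`.  This file is pure finite
Fourier analysis on the cube, independent of the line's vocabulary: the Walsh form `Θ(s) = Σ_S θ_S ∏_{i∈S} s_i`
at a sign vector (`wEval`), the sign patterns "`b` at `i₀`, `−1` on `D`, `+1` elsewhere" (`pat`), the Walsh
characters as sign functions (`ySign`), their factorisation at a pattern (`prod_pat`), ORTHOGONALITY
(`sum_powerset_prod_ySign_mul`, via `Finset.prod_add`), the MARGINAL SUMS `Σ_{E ⊆ U} Θ(E, b) = 2^{|U|}(1 + b θ_{{i₀}})`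
(`sum_wEval_pat`) and WALSH INVERSION in the coordinates of `U = [t] ∖ {i₀}` (`walshInversion`, a registered
sub-goal of the line).  The clipping lemma itself (corner index vectors, NLC, the linear bound) is in
`Theorems/LeeYangFibresAbsoluteUpgradeWalshClipping.lean`.

References: Walsh–Fourier analysis on `{±1}^t` is folklore (e.g. O'Donnell, *Analysis of Boolean Functions*, Ch. 1).
-/

noncomputable section

open scoped BigOperators Classical
open Finset

namespace Summit.Parity.GeneralizedHardyLittlewood.Theorems.AbsoluteUpgrade

namespace WalshClip

variable {t : ℕ}

/-! ### Walsh forms at sign vectors -/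

/-- The Walsh form evaluated at a sign vector `s : [t] → {±1}`: `Σ_S θ_S ∏_{i∈S} s_i`. [folklore] -/
def wEval (θ : Finset (Fin t) → ℝ) (s : Fin t → ℝ) : ℝ :=
  ∑ S : Finset (Fin t), θ S * ∏ i ∈ S, s i

/-- `|Θ(s)| ≤ 2·2^t` when `|θ_S| ≤ 2` and `|s_i| = 1`. [folklore] -/
theorem abs_wEval_le {θ : Finset (Fin t) → ℝ} (hθ : ∀ S, |θ S| ≤ 2) {s : Fin t → ℝ}
    (hs : ∀ i, |s i| = 1) : |wEval θ s| ≤ 2 * 2 ^ t := by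
  unfold wEval
  calc |∑ S : Finset (Fin t), θ S * ∏ i ∈ S, s i|
      ≤ ∑ S : Finset (Fin t), |θ S * ∏ i ∈ S, s i| := Finset.abs_sum_le_sum_abs _ _
    _ ≤ ∑ _S : Finset (Fin t), (2 : ℝ) := Finset.sum_le_sum fun S _ => by
        rw [abs_mul, Finset.abs_prod, Finset.prod_eq_one fun i _ => hs i, mul_one]
        exact hθ S
    _ = 2 * 2 ^ t := by
        rw [Finset.sum_const, nsmul_eq_mul, Finset.card_univ, Fintype.card_finset, Fintype.card_fin]
        push_cast; ring

/-- The sign pattern with value `b` at `i₀`, `-1` on `D` and `+1` elsewhere. [folklore] -/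
def pat (i₀ : Fin t) (D : Finset (Fin t)) (b : ℝ) : Fin t → ℝ :=
  fun i => if i = i₀ then b else if i ∈ D then -1 else 1

/-- The Walsh character of `S` as a sign function: `y^S_i = -1` if `i ∈ S`, else `+1`. [folklore] -/
def ySign (S : Finset (Fin t)) (i : Fin t) : ℝ := if i ∈ S then -1 else 1

/-- `|pat_i| = 1` when `|b| = 1`. [folklore] -/
theorem abs_pat {i₀ : Fin t} {D : Finset (Fin t)} {b : ℝ} (hb : |b| = 1) (i : Fin t) :
    |pat i₀ D b i| = 1 := by
  unfold pat; split_ifs <;> simp [hb]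

/-- `∏_{i∈D} y^S_i = (-1)^{#(D ∩ S)}`. [folklore] -/
theorem prod_ySign (S D : Finset (Fin t)) : ∏ i ∈ D, ySign S i = (-1 : ℝ) ^ (D ∩ S).card := by
  unfold ySign
  rw [Finset.prod_ite_mem, Finset.prod_const]

/-- **Factorisation of a Walsh character at a pattern** (`i₀ ∉ D`):
`∏_{i∈S} pat_i = b^{[i₀ ∈ S]} · ∏_{i ∈ D} y^S_i`. [folklore] -/
theorem prod_pat {i₀ : Fin t} {D : Finset (Fin t)} (hD : i₀ ∉ D) (b : ℝ) (S : Finset (Fin t)) :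
    ∏ i ∈ S, pat i₀ D b i = (if i₀ ∈ S then b else 1) * ∏ i ∈ D, ySign S i := by
  have hpt : ∀ i ∈ S, pat i₀ D b i = (if i = i₀ then b else 1) * (if i ∈ D then -1 else 1) := by
    intro i _
    unfold pat
    by_cases hi : i = i₀
    · subst hi; simp [hD]
    · simp [hi]
  rw [Finset.prod_congr rfl hpt, Finset.prod_mul_distrib, Finset.prod_ite_eq' S i₀ (fun _ => b),
    Finset.prod_ite_mem, Finset.prod_const, prod_ySign, Finset.inter_comm]

/-- **Orthogonality of the Walsh characters on `U`**:
`Σ_{D ⊆ U} ∏_{i∈D} y^S_i y^{S'}_i = 2^{|U|}` if `S, S'` agree on `U`, and `0` otherwise. [folklore] -/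
theorem sum_powerset_prod_ySign_mul (U S S' : Finset (Fin t)) :
    ∑ D ∈ U.powerset, ∏ i ∈ D, (ySign S i * ySign S' i) =
      if ∀ i ∈ U, (i ∈ S ↔ i ∈ S') then (2 : ℝ) ^ U.card else 0 := by
  have key : ∑ D ∈ U.powerset, ∏ i ∈ D, (ySign S i * ySign S' i) =
      ∏ i ∈ U, (ySign S i * ySign S' i + 1) := by
    rw [Finset.prod_add]
    refine Finset.sum_congr rfl fun D _ => ?_
    rw [Finset.prod_const_one, mul_one]
  rw [key]
  have hfac : ∀ i, ySign S i * ySign S' i + 1 = if (i ∈ S ↔ i ∈ S') then (2 : ℝ) else 0 := by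
    intro i; unfold ySign
    by_cases h1 : i ∈ S <;> by_cases h2 : i ∈ S' <;> simp [h1, h2] <;> norm_num
  simp_rw [hfac]
  split_ifs with hall
  · rw [Finset.prod_congr rfl fun i hi => if_pos (hall i hi), Finset.prod_const]
  · obtain ⟨i, hi⟩ := not_forall.mp hall
    obtain ⟨hiU, hi⟩ := Classical.not_imp.mp hi
    exact Finset.prod_eq_zero hiU (if_neg hi)

/-- Orthogonality against the trivial character: `Σ_{D ⊆ U} ∏_{i∈D} y^S_i = 2^{|U|}` if `S ∩ U = ∅`,
else `0`. [folklore] -/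
theorem sum_powerset_prod_ySign (U S : Finset (Fin t)) :
    ∑ D ∈ U.powerset, ∏ i ∈ D, ySign S i = if ∀ i ∈ U, i ∉ S then (2 : ℝ) ^ U.card else 0 := by
  have h := sum_powerset_prod_ySign_mul U S ∅
  have h1 : ∀ D ∈ U.powerset, ∏ i ∈ D, (ySign S i * ySign ∅ i) = ∏ i ∈ D, ySign S i := by
    intro D _
    refine Finset.prod_congr rfl fun i _ => ?_
    simp [ySign]
  rw [Finset.sum_congr rfl h1] at h
  rw [h]
  simp

/-! ### Marginal sums and Walsh inversion in the coordinates of `U = [t] ∖ {i₀}` -/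

/-- **Marginal sums.** With `θ_∅ = 1`: `Σ_{E ⊆ U} Θ(E, b) = 2^{|U|} (1 + b θ_{{i₀}})`, `U = [t] ∖ {i₀}`. [folklore] -/
theorem sum_wEval_pat (θ : Finset (Fin t) → ℝ) (hθ0 : θ ∅ = 1) (i₀ : Fin t) (b : ℝ) :
    ∑ E ∈ (Finset.univ.erase i₀).powerset, wEval θ (pat i₀ E b) =
      (2 : ℝ) ^ (Finset.univ.erase i₀).card * (1 + b * θ {i₀}) := by
  set U : Finset (Fin t) := Finset.univ.erase i₀ with hU
  have hEU : ∀ E ∈ U.powerset, i₀ ∉ E := fun E hE h =>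
    (Finset.notMem_erase i₀ Finset.univ) (Finset.mem_powerset.mp hE h)
  -- expand and swap the sums
  have h1 : ∑ E ∈ U.powerset, wEval θ (pat i₀ E b) =
      ∑ S : Finset (Fin t), θ S * (if i₀ ∈ S then b else 1) * ∑ E ∈ U.powerset, ∏ i ∈ E, ySign S i := by
    unfold wEval
    rw [Finset.sum_comm]
    refine Finset.sum_congr rfl fun S _ => ?_
    rw [Finset.mul_sum]
    refine Finset.sum_congr rfl fun E hE => ?_
    rw [prod_pat (hEU E hE) b S]; ring
  rw [h1]
  -- only `S = ∅` and `S = {i₀}` survive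
  have hvan : ∀ S : Finset (Fin t), S ≠ ∅ → S ≠ {i₀} →
      θ S * (if i₀ ∈ S then b else 1) * ∑ E ∈ U.powerset, ∏ i ∈ E, ySign S i = 0 := by
    intro S hS0 hS1
    have hcond : ¬ ∀ i ∈ U, i ∉ S := by
      intro hall
      -- then `S ⊆ {i₀}`, so `S = ∅` or `S = {i₀}`
      have hsub : S ⊆ {i₀} := by
        intro i hi
        rw [Finset.mem_singleton]
        by_contra hne
        exact hall i (Finset.mem_erase.mpr ⟨hne, Finset.mem_univ i⟩) hi
      rcases Finset.subset_singleton_iff.mp hsub with h | h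
      · exact hS0 h
      · exact hS1 h
    rw [sum_powerset_prod_ySign, if_neg hcond, mul_zero]
  have hne : (∅ : Finset (Fin t)) ≠ {i₀} := (Finset.singleton_ne_empty i₀).symm
  rw [Finset.sum_eq_add (∅ : Finset (Fin t)) {i₀} hne (fun S _ hS => hvan S hS.1 hS.2)
    (fun h => absurd (Finset.mem_univ _) h) (fun h => absurd (Finset.mem_univ _) h)]
  have hA : ∑ E ∈ U.powerset, ∏ i ∈ E, ySign (∅ : Finset (Fin t)) i = (2 : ℝ) ^ U.card := by
    rw [sum_powerset_prod_ySign, if_pos]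
    exact fun i _ => Finset.notMem_empty i
  have hB : ∑ E ∈ U.powerset, ∏ i ∈ E, ySign ({i₀} : Finset (Fin t)) i = (2 : ℝ) ^ U.card := by
    rw [sum_powerset_prod_ySign, if_pos]
    intro i hi
    rw [Finset.mem_singleton]
    exact (Finset.mem_erase.mp hi).1
  rw [hA, hB]
  simp [hθ0]
  ring

/-- The difference `Θ(D,+) − Θ(D,−) = 2 Σ_{S ∋ i₀} θ_S ∏_{i∈D} y^S_i` (`i₀ ∉ D`). [folklore] -/
theorem wEval_pat_sub (θ : Finset (Fin t) → ℝ) {i₀ : Fin t} {D : Finset (Fin t)} (hD : i₀ ∉ D) :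
    wEval θ (pat i₀ D 1) - wEval θ (pat i₀ D (-1)) =
      2 * ∑ S ∈ Finset.univ.filter (fun S : Finset (Fin t) => i₀ ∈ S), θ S * ∏ i ∈ D, ySign S i := by
  unfold wEval
  rw [← Finset.sum_sub_distrib, Finset.mul_sum, Finset.sum_filter]
  refine Finset.sum_congr rfl fun S _ => ?_
  rw [prod_pat hD 1 S, prod_pat hD (-1) S]
  split_ifs <;> ring

/-- **Walsh inversion in the coordinates of `U = [t] ∖ {i₀}`** (registered sub-goal of the line,
helper for `stub_walshClipping`). For `S₀ ∋ i₀`: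
`Σ_{D ⊆ U} (∏_{i∈D} y^{S₀}_i) (Θ(D,+) − Θ(D,−)) = 2 · 2^{|U|} θ_{S₀}`. [folklore] -/
theorem walshInversion : ∀ {t : ℕ} (θ : Finset (Fin t) → ℝ) {i₀ : Fin t} {S₀ : Finset (Fin t)}, i₀ ∈ S₀ → ∑ D ∈ (Finset.univ.erase i₀).powerset, (∏ i ∈ D, ySign S₀ i) * (wEval θ (pat i₀ D 1) - wEval θ (pat i₀ D (-1))) = 2 * (2 : ℝ) ^ (Finset.univ.erase i₀).card * θ S₀ := by
  intro t θ i₀ S₀ h₀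
  set U : Finset (Fin t) := Finset.univ.erase i₀ with hU
  have hDU : ∀ D ∈ U.powerset, i₀ ∉ D := fun D hD h =>
    (Finset.notMem_erase i₀ Finset.univ) (Finset.mem_powerset.mp hD h)
  set F : Finset (Finset (Fin t)) := Finset.univ.filter (fun S : Finset (Fin t) => i₀ ∈ S) with hF
  have h1 : ∑ D ∈ U.powerset, (∏ i ∈ D, ySign S₀ i) * (wEval θ (pat i₀ D 1) - wEval θ (pat i₀ D (-1))) =
      ∑ S ∈ F, 2 * θ S * ∑ D ∈ U.powerset, ∏ i ∈ D, (ySign S₀ i * ySign S i) := by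
    have h2 : ∀ D ∈ U.powerset,
        (∏ i ∈ D, ySign S₀ i) * (wEval θ (pat i₀ D 1) - wEval θ (pat i₀ D (-1))) =
          ∑ S ∈ F, 2 * θ S * ∏ i ∈ D, (ySign S₀ i * ySign S i) := by
      intro D hD
      rw [wEval_pat_sub θ (hDU D hD), Finset.mul_sum, Finset.mul_sum]
      refine Finset.sum_congr rfl fun S _ => ?_
      rw [Finset.prod_mul_distrib]; ring
    rw [Finset.sum_congr rfl h2, Finset.sum_comm]
    refine Finset.sum_congr rfl fun S _ => ?_
    rw [Finset.mul_sum]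
  rw [h1]
  have h₀F : S₀ ∈ F := Finset.mem_filter.mpr ⟨Finset.mem_univ _, h₀⟩
  rw [Finset.sum_eq_single_of_mem S₀ h₀F]
  · rw [sum_powerset_prod_ySign_mul, if_pos (fun i _ => Iff.rfl)]; ring
  · intro S hS hne
    rw [sum_powerset_prod_ySign_mul, if_neg, mul_zero]
    intro hall
    apply hne
    ext i
    by_cases hi : i = i₀
    · subst hi
      exact ⟨fun _ => h₀, fun _ => (Finset.mem_filter.mp hS).2⟩
    · exact (hall i (Finset.mem_erase.mpr ⟨hi, Finset.mem_univ i⟩)).symm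

end WalshClip

end Summit.Parity.GeneralizedHardyLittlewood.Theorems.AbsoluteUpgrade

end
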